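/-
Copyright (c) 2026 the pub-hodgecm-mathlib formalisation cell (harness21).  Prover seat hodgecm-mathlib-LH4-p11 (g7), req620 Track A «(D-RAM) FOUR-FRAME» squad
(dealer LH4-plan (g13) WORD #65 (2) «(T5s♭-RamM) → LH4-p11 (g7)»; ★ lineage LH4-p04 (g4) `toricCensusSum_ramM` p857711 ∕ `…RamMParts` p857695; consumer LH4-p07 (g9) (LAW)).
-/
import Summits.HodgeConjecture.HodgeConjecture.Theorems.F0P3cDyRamToricCensusSumRamMParts   -- ★ p857695 (LH4-p04 (g4)): `tables_diff_ramM`, `col_zero_ramM`, `col_pos_ramM`; brings ★ RamK parts + ★ Unr blocks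
import HarnessLib

/-!
# Crux `H413`, line LH4 «(D-RAM) FOUR-FRAME» — O-Sum ∕ T5s♭ «TORIC CENSUS SUM», TYPE RamM, THE FLIPPED PARITY CLASS `jl ≢ g`, `m ≢ d_E`:
# `ε·Σ_{j ≤ jl} Σ_a q^a (dep₊(j,a) − dep₋(j,a)) = q^m·(2[(jl + 1 − g)∕2 + d_E%2]_q − 2[d_E − 1 + d_E%2]_q)`

Cell `hodgecm-mathlib` (D-0151), FLOOR 0, crux item H413 = `stmt-HodgeConjecture-24833`, route of record `HCCMUnconditional`; squad F0∕P3c∕LH4, STAGE-1b letters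
`stub_law_levLo ∕ stub_law_levHi` of the tier-0 line `Cruxes/H413/Lines/F0_P3c_DyRamFourFrame.lean` ED. 5 through LH4-p07 (g9)'s census-law cone: the level piece
`lev_{a′,b′}` shifts BOTH tokens `(m, jl) ↦ (m − a′, jl − a′)` (cells of `μ₁ = (jE ϖ_E^{a′})⁻¹(lam − jE u₀₀)`, ★ (T5-P-cut) `F0P3cDyRamJointProfileCensusCutoff`), so for ODD `a′`
— exactly one of lev_lo ∕ lev_hi at every `d` (LH4-p07 LAW-FIT-RamK §2 (a)) — the shifted tokens live in the parity class `jl ≢ g`, `m ≢ d_E` that ★ `toricCensusSum_ramM`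
(`hjl : jl ≡ g`, `hpar : m ≡ d_E`) does not cover.  THEOREMS ONLY (no `def`, no instance, no notation, no `sorry`); lane `--supports stmt-HodgeConjecture-24833 --as helper`.

THE STATEMENT (digits + END signature posted first, `F0/P3c/LH4/LH4-p11/g7/t5s_flip/SIG-T5s-flip-RamM.v1.LH4p11g7.md`; twin `t5s_ramM_flip_twin.v1.LH4p11g7.py` over LH4-p04
(g4)'s ★-validated `head_twin_ramM.v1` tables: 6708∕6708 tuples, q ≤ 8, g, s0 ≤ 5, jl ≤ 20, both signs; `hjlS`, `hmS` and the ε-window SHARP).  The five TABLE BINDERS `hnP hnM hvGen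
hvOff hvTop` are ★ `toricCensusSum_ramM`'s VERBATIM; the token letters become `jl ≡ g + 1 (2)`, `m ≡ d_E + 1 (2)`, `3g + 2s0 ≤ jl + 3` (i.e. `S♭ := d_E − 1 + d_E%2 ≤ n♭_H :=
(jl + 1 − g)∕2 + d_E%2`), `d_E ≤ m + 1`, `m ≤ jl`, the SAME window `ε = +1` or (`ε = −1` and `jl + 2 ≤ m + 2g + s0`); the value is `q^m·(2[n♭_H]_q − 2[S♭]_q)`.
PROOF = ★'s skeleton token for token: columns first (★ `col_zero_ramM` ∕ `col_pos_ramM` are parity-free); in the window the generic columns and the column `a = 0` cancel (★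
`genBlock_mul`) and the top cells re-index to the block `[m + S♭ − ⌊(jl+s0)∕2⌋ − 1, m − ⌊d_E∕2⌋)` of length `n♭_H − S♭` worth `2x^{m+S♭}·x^i`; beyond the window (`ε = +1`)
generic columns `a + 1 ≤ ⌊m∕2⌋`, top cells `⌊m∕2⌋ ≤ a < m − ⌊d_E∕2⌋`, one multiplication by `x − 1` and `ring` in ★'s atoms `x^{⌈m∕2⌉−⌊d_E∕2⌋}, x^{⌊d_E∕2⌋−1},
x^{⌊(jl−s0)∕2⌋−⌊m∕2⌋−g}, x` with the flipped-parity decompositions.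
HONEST LABEL.  Count-neutral (`--supports`); nothing printed is asserted; no census∕volume law is proved here; `HC_CM` is proved only modulo the 7 printed citations (2 remaining
named inputs: hLiu418 = `stmt-HodgeConjecture-24832`, h413 = `stmt-HodgeConjecture-24833`) until rung 0 closes.

## References
* [Kottwitz1986BaseChangeUnits] R. E. Kottwitz, *Base change for unit elements of Hecke algebras*, Compositio Math. 60 (1986), §1 pp. 240–241 (orbital integrals of units as
  lattice counts modulo the torus).
* [Rogawski1990] J. D. Rogawski, *Automorphic Representations of Unitary Groups in Three Variables*, Ann. of Math. Stud. 123 (1990), §4.9 Prop. 4.9.1 (b) p. 55, Lemma 4.9.3 p. 56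
  (the fixed-point census of a type-(2) element; the toric decomposition).
* [Flicker1998UnitaryFL] Y. Z. Flicker, *Elementary proof of the fundamental lemma for a unitary group*, Canad. J. Math. 50 (1998): Prop. 7 p. 84 (the level tables).
* [Serre1979] J.-P. Serre, *Local Fields*, GTM 67 (1979): Ch. V §3 Cor. 3 (the norm on the unit filtration; the Hasse–Herbrand break).
-/

set_option autoImplicit false

namespace Summit.HodgeConjecture.HodgeConjecture.Cruxes.H413.F0P3cDyRamToricCensusSumRamMFlip

open Finset
open Summit.HodgeConjecture.HodgeConjecture.Cruxes.H413.F0P3cDyRamToricCensusSumUnrBlocks (sum_range_window_reindex geom_sum_mul')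
open Summit.HodgeConjecture.HodgeConjecture.Cruxes.H413.F0P3cDyRamToricCensusSumRamKParts (genBlock_mul topBlock_mul)
open Summit.HodgeConjecture.HodgeConjecture.Cruxes.H413.F0P3cDyRamToricCensusSumRamMParts

set_option maxHeartbeats 400000 in
/-- **THE FAR-CASE POLYNOMIAL IDENTITY** (`ε = +1`, beyond the window) of `toricCensusSum_ramM_flip`, isolated for the heartbeat budget: after ★ `genBlock_mul` ∕
`topBlock_mul` ∕ the column `a = 0`, the two sides agree — `ring` in the atoms `x^{⌈m∕2⌉−⌊d_E∕2⌋}, x^{⌊d_E∕2⌋−1}, x^{⌊(jl−s0)∕2⌋−⌊m∕2⌋−g}, x` per parity of `d_E`,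
the floors pinned by the parity witnesses `jl + 1 = g + 2n`, `m + 1 = d_E + 2k`. [cite: Flicker1998UnitaryFL, Prop. 7 p. 84] -/
theorem far_identity_flip (x : ℚ) {g s0 jl m n k : ℕ} (hg : 1 ≤ g) (hs0 : 1 ≤ s0) (hmS : g + s0 ≤ m + 1) (hm : m ≤ jl)
    (hfar : m + 2 * g + s0 < jl + 2) (hn : jl + 1 = g + 2 * n) (hk : m + 1 = g + s0 + 2 * k)
    (e1 : (jl + s0) / 2 + 1 = n + (g + s0) / 2 + (g + s0) % 2) (e2 : m / 2 + 1 = k + (g + s0) / 2 + (g + s0) % 2)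
    (e3 : (jl + 1 - g) / 2 = n) (e4 : (jl - s0) / 2 + s0 = (jl + s0) / 2) :
    2 * x ^ ((jl + s0) / 2 + 1) * (x ^ (m / 2) - 1) - 2 * x ^ (g + s0) * (x ^ (2 * (m / 2)) - 1) +
        2 * x ^ ((jl + s0) / 2 + m / 2 + 1) * (x ^ (m - (g + s0) / 2 - m / 2) - 1) + 2 * x ^ (g + s0) * (x ^ ((jl - s0) / 2 + 1 - g) - 1) =
      2 * x ^ m * (x ^ ((jl + 1 - g) / 2 + (g + s0) % 2) - x ^ (g + s0 - 1 + (g + s0) % 2)) := by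
  -- atoms: `x^r` (`r = ⌈m∕2⌉ − ⌊d_E∕2⌋`), `x^t` (`t = ⌊d_E∕2⌋ − 1`), `x^u` (`u = ⌊(jl−s0)∕2⌋ − ⌊m∕2⌋ − g`), `x`
  rcases Nat.mod_two_eq_zero_or_one (g + s0) with hδ | hδ
  · have f1 : x ^ ((jl + s0) / 2 + 1) = x ^ (m - (g + s0) / 2 - m / 2) * x ^ ((g + s0) / 2 - 1) * x ^ ((g + s0) / 2 - 1) * x ^ ((g + s0) / 2 - 1) * x ^ ((jl - s0) / 2 - m / 2 - g) * x * x * x := by simp only [← pow_add, ← pow_succ]; congr 1; omega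
    have f2 : x ^ (m / 2) = x ^ (m - (g + s0) / 2 - m / 2) * x ^ ((g + s0) / 2 - 1) := by simp only [← pow_add]; congr 1; omega
    have f3 : x ^ (g + s0) = x ^ ((g + s0) / 2 - 1) * x ^ ((g + s0) / 2 - 1) * x * x := by simp only [← pow_add, ← pow_succ]; congr 1; omega
    have f4 : x ^ (2 * (m / 2)) = x ^ (m - (g + s0) / 2 - m / 2) * x ^ (m - (g + s0) / 2 - m / 2) * x ^ ((g + s0) / 2 - 1) * x ^ ((g + s0) / 2 - 1) := by simp only [← pow_add]; congr 1; omega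
    have f5 : x ^ ((jl + s0) / 2 + m / 2 + 1) = x ^ (m - (g + s0) / 2 - m / 2) * x ^ (m - (g + s0) / 2 - m / 2) * x ^ ((g + s0) / 2 - 1) * x ^ ((g + s0) / 2 - 1) * x ^ ((g + s0) / 2 - 1) * x ^ ((g + s0) / 2 - 1) * x ^ ((jl - s0) / 2 - m / 2 - g) * x * x * x := by simp only [← pow_add, ← pow_succ]; congr 1; omega
    have f6 : x ^ ((jl - s0) / 2 + 1 - g) = x ^ (m - (g + s0) / 2 - m / 2) * x ^ ((g + s0) / 2 - 1) * x ^ ((jl - s0) / 2 - m / 2 - g) * x := by simp only [← pow_add, ← pow_succ]; congr 1; omega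
    have f7 : x ^ m = x ^ (m - (g + s0) / 2 - m / 2) * x ^ (m - (g + s0) / 2 - m / 2) * x ^ ((g + s0) / 2 - 1) * x ^ ((g + s0) / 2 - 1) * x := by simp only [← pow_add, ← pow_succ]; congr 1; omega
    have f8 : x ^ ((jl + 1 - g) / 2 + (g + s0) % 2) = x ^ (m - (g + s0) / 2 - m / 2) * x ^ ((g + s0) / 2 - 1) * x ^ ((g + s0) / 2 - 1) * x ^ ((jl - s0) / 2 - m / 2 - g) * x * x := by simp only [← pow_add, ← pow_succ]; congr 1; omega
    have f9 : x ^ (g + s0 - 1 + (g + s0) % 2) = x ^ ((g + s0) / 2 - 1) * x ^ ((g + s0) / 2 - 1) * x := by simp only [← pow_add, ← pow_succ]; congr 1; omega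
    rw [f1, f2, f3, f4, f5, f6, f7, f8, f9]; ring
  · have f1 : x ^ ((jl + s0) / 2 + 1) = x ^ (m - (g + s0) / 2 - m / 2) * x ^ ((g + s0) / 2 - 1) * x ^ ((g + s0) / 2 - 1) * x ^ ((g + s0) / 2 - 1) * x ^ ((jl - s0) / 2 - m / 2 - g) * x * x * x * x * x := by simp only [← pow_add, ← pow_succ]; congr 1; omega
    have f2 : x ^ (m / 2) = x ^ (m - (g + s0) / 2 - m / 2) * x ^ ((g + s0) / 2 - 1) * x := by simp only [← pow_add, ← pow_succ]; congr 1; omega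
    have f3 : x ^ (g + s0) = x ^ ((g + s0) / 2 - 1) * x ^ ((g + s0) / 2 - 1) * x * x * x := by simp only [← pow_add, ← pow_succ]; congr 1; omega
    have f4 : x ^ (2 * (m / 2)) = x ^ (m - (g + s0) / 2 - m / 2) * x ^ (m - (g + s0) / 2 - m / 2) * x ^ ((g + s0) / 2 - 1) * x ^ ((g + s0) / 2 - 1) * x * x := by simp only [← pow_add, ← pow_succ]; congr 1; omega
    have f5 : x ^ ((jl + s0) / 2 + m / 2 + 1) = x ^ (m - (g + s0) / 2 - m / 2) * x ^ (m - (g + s0) / 2 - m / 2) * x ^ ((g + s0) / 2 - 1) * x ^ ((g + s0) / 2 - 1) * x ^ ((g + s0) / 2 - 1) * x ^ ((g + s0) / 2 - 1) * x ^ ((jl - s0) / 2 - m / 2 - g) * x * x * x * x * x * x := by simp only [← pow_add, ← pow_succ]; congr 1; omega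
    have f6 : x ^ ((jl - s0) / 2 + 1 - g) = x ^ (m - (g + s0) / 2 - m / 2) * x ^ ((g + s0) / 2 - 1) * x ^ ((jl - s0) / 2 - m / 2 - g) * x * x := by simp only [← pow_add, ← pow_succ]; congr 1; omega
    have f7 : x ^ m = x ^ (m - (g + s0) / 2 - m / 2) * x ^ (m - (g + s0) / 2 - m / 2) * x ^ ((g + s0) / 2 - 1) * x ^ ((g + s0) / 2 - 1) * x * x := by simp only [← pow_add, ← pow_succ]; congr 1; omega
    have f8 : x ^ ((jl + 1 - g) / 2 + (g + s0) % 2) = x ^ (m - (g + s0) / 2 - m / 2) * x ^ ((g + s0) / 2 - 1) * x ^ ((g + s0) / 2 - 1) * x ^ ((jl - s0) / 2 - m / 2 - g) * x * x * x * x := by simp only [← pow_add, ← pow_succ]; congr 1; omega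
    have f9 : x ^ (g + s0 - 1 + (g + s0) % 2) = x ^ ((g + s0) / 2 - 1) * x ^ ((g + s0) / 2 - 1) * x * x * x := by simp only [← pow_add, ← pow_succ]; congr 1; omega
    rw [f1, f2, f3, f4, f5, f6, f7, f8, f9]; ring

set_option maxHeartbeats 400000 in
/-- **O-SUM ∕ T5s♭, TYPE RamM — THE TORIC CENSUS SUM IN THE FLIPPED PARITY CLASS `jl ≢ g`, `m ≢ d_E`.**  Parameters `g = dΘ∕2`, `s0 = dτ∕2` (`d_E = g + s0`); the u-free
level tables `nP nM` and the depth rules `vP vM` at the tokens `(m, ε)` are ★ `toricCensusSum_ramM`'s VERBATIM (binders `hnP hnM hvGen hvOff hvTop`).  Then for `q ≥ 2`,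
`g, s0 ≥ 1`, `jl ≡ g + 1 (2)`, `m ≡ d_E + 1 (2)`, `3g + 2s0 ≤ jl + 3`, `d_E ≤ m + 1`, `m ≤ jl`, `ε = +1` or (`ε = −1` and `jl + 2 ≤ m + 2g + s0`):
`ε·Σ_{j ≤ jl} Σ_a q^a (vP j a − vM j a) = q^m·(2[(jl + 1 − g)∕2 + d_E%2]_q − 2[d_E − 1 + d_E%2]_q)` — the O-Sum organ of the level pieces of ODD depth shift `a′`, type RM
(the tokens `(m, jl)` of ★ read at `(m − a′, jl − a′)`).  Statement validated by a Lean-semantics twin (6708 tuples, q ≤ 8, g,s0 ≤ 5, jl ≤ 20, both signs; thresholds sharp).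
[cite: Kottwitz1986BaseChangeUnits, §1 pp. 240–241] [cite: Rogawski1990, §4.9 Prop. 4.9.1 (b) p. 55, Lemma 4.9.3 p. 56] [cite: Flicker1998UnitaryFL, Prop. 7 p. 84] [cite: Serre1979, Ch. V §3 Cor. 3] -/
theorem toricCensusSum_ramM_flip (q : ℕ) {g s0 jl m : ℕ} (ε : ℚ) (hq : 2 ≤ q) (hg : 1 ≤ g) (hs0 : 1 ≤ s0) (hjl : jl % 2 = (g + 1) % 2)
    (hjlS : 3 * g + 2 * s0 ≤ jl + 3) (hpar : m % 2 = (g + s0 + 1) % 2) (hmS : g + s0 ≤ m + 1) (hm : m ≤ jl)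
    (hε : ε = 1 ∨ (ε = -1 ∧ jl + 2 ≤ m + 2 * g + s0))
    (nP nM vP vM : ℕ → ℕ → ℚ)
    (hnP : ∀ j a, nP j a = ((if j = 0 then (if a = 0 then 1 else 0) else if j < a then 0
      else if j - a + 1 = s0 then q ^ j else if j - a + 1 < s0 then (if a = 0 then q ^ j else 0) else if (j - a - s0) % 2 = 1 then 0
      else if a = 0 then (if 2 * g ≤ j - a - s0 then 2 else 1) * q ^ (j - (j - a - s0) / 2)
      else if j - a - s0 + 2 < 2 * g then (q - 1) * q ^ (j - 1 - (j - a - s0) / 2) else if j - a - s0 + 2 = 2 * g then (q - 2) * q ^ (j - 1 - (j - a - s0) / 2)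
      else 2 * (q - 1) * q ^ (j - 1 - (j - a - s0) / 2) : ℕ) : ℚ))
    (hnM : ∀ j a, nM j a = ((if j = 0 then (if a = 0 then 1 else 0) else if j < a then 0
      else if j - a + 1 = s0 then q ^ j else if j - a + 1 < s0 then (if a = 0 then q ^ j else 0) else if (j - a - s0) % 2 = 1 then 0
      else if a = 0 then (if j - a - s0 + 2 ≤ 2 * g then q ^ (j - (j - a - s0) / 2) else 0)
      else if j - a - s0 + 2 < 2 * g then (q - 1) * q ^ (j - 1 - (j - a - s0) / 2) else if j - a - s0 + 2 = 2 * g then q ^ (j - (j - a - s0) / 2) else 0 : ℕ) : ℚ))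
    (hvGen : ∀ j a, (a ≤ m ∧ (j + a ≤ m ∨ (2 * a ≤ m ∧ j + a ≤ jl))) → vP j a = nP j a ∧ vM j a = nM j a)
    (hvOff : ∀ j a, ¬ (a ≤ m ∧ (j + a ≤ m ∨ (2 * a ≤ m ∧ j + a ≤ jl))) → j + m ≠ jl + a → vP j a = 0 ∧ vM j a = 0)
    (hvTop : ∀ j a, ¬ (a ≤ m ∧ (j + a ≤ m ∨ (2 * a ≤ m ∧ j + a ≤ jl))) → j + m = jl + a →
      (vP j a = if 2 * j + (g + s0) ≤ 2 * jl + 1 ∧ (j + a + 2 ≤ m + s0 + 2 * g ∨ ε = 1) then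
          (if j + a < m + s0 then (q : ℚ) ^ j else (if 2 * g ≤ j + a - m - s0 + 1 then 2 else 1) * (q : ℚ) ^ (j - (j + a - m - s0 + 1) / 2)) else 0) ∧
      (vM j a = if 2 * j + (g + s0) ≤ 2 * jl + 1 ∧ (j + a + 2 ≤ m + s0 + 2 * g ∨ ε = -1) then
          (if j + a < m + s0 then (q : ℚ) ^ j else (if 2 * g ≤ j + a - m - s0 + 1 then 2 else 1) * (q : ℚ) ^ (j - (j + a - m - s0 + 1) / 2)) else 0)) :
    ε * ∑ j ∈ range (jl + 1), ∑ a ∈ range (jl + 2), (q : ℚ) ^ a * (vP j a - vM j a) =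
      (q : ℚ) ^ m * (2 * ∑ i ∈ range ((jl + 1 - g) / 2 + (g + s0) % 2), (q : ℚ) ^ i - 2 * ∑ i ∈ range (g + s0 - 1 + (g + s0) % 2), (q : ℚ) ^ i) := by
  set x : ℚ := (q : ℚ) with hxq
  have hx1 : x ≠ 1 := by rw [hxq]; exact_mod_cast (show q ≠ 1 by omega)
  have hε' : ε = 1 ∨ ε = -1 := hε.imp_right And.left
  have hεε : ε * ε = 1 := by rcases hε' with rfl | rfl <;> norm_num
  -- parity witnesses of the flipped class (`jl + 1 = g + 2n`, `m + 1 = d_E + 2k`) and the floors they determine (fed to `omega`)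
  obtain ⟨n, k, hn, hk, e1, e2, e3, e4⟩ : ∃ n k : ℕ, jl + 1 = g + 2 * n ∧ m + 1 = g + s0 + 2 * k ∧
      (jl + s0) / 2 + 1 = n + (g + s0) / 2 + (g + s0) % 2 ∧ m / 2 + 1 = k + (g + s0) / 2 + (g + s0) % 2 ∧
      (jl + 1 - g) / 2 = n ∧ (jl - s0) / 2 + s0 = (jl + s0) / 2 :=
    ⟨(jl + 1 - g) / 2, (m + 1 - (g + s0)) / 2, by omega, by omega, by omega, by omega, rfl, by omega⟩
  have hδ : ∀ j a, nP j a - nM j a = if a + s0 ≤ j ∧ (j - (a + s0)) % 2 = 0 then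
      (if a = 0 then (if 2 * g ≤ j - s0 then 2 * x ^ (j - (j - s0) / 2) else 0)
       else (if j - a - s0 + 2 = 2 * g then -2 * x ^ (j - 1 - (j - a - s0) / 2)
         else if 2 * g < j - a - s0 + 2 then 2 * (x - 1) * x ^ (j - 1 - (j - a - s0) / 2) else 0)) else 0 := fun j a => by rw [hnP, hnM]; exact tables_diff_ramM q hq hg j a
  -- columns first
  rw [Finset.sum_comm, Finset.sum_range_succ', col_zero_ramM x hg nP nM vP vM hδ hvGen,
    Finset.sum_congr rfl (fun a _ => col_pos_ramM x ε hε' hg hm nP nM vP vM hδ hvGen hvOff hvTop (show 1 ≤ a + 1 by omega)),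
    Finset.sum_add_distrib, ← Finset.mul_sum]
  -- the RHS, multiplied by `x − 1`
  have hR : (x - 1) * (x ^ m * (2 * ∑ i ∈ range ((jl + 1 - g) / 2 + (g + s0) % 2), x ^ i - 2 * ∑ i ∈ range (g + s0 - 1 + (g + s0) % 2), x ^ i)) =
      2 * x ^ m * (x ^ ((jl + 1 - g) / 2 + (g + s0) % 2) - x ^ (g + s0 - 1 + (g + s0) % 2)) := by
    have h1 := geom_sum_mul' x ((jl + 1 - g) / 2 + (g + s0) % 2)
    have h2 := geom_sum_mul' x (g + s0 - 1 + (g + s0) % 2)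
    linear_combination (2 * x ^ m) * h1 - (2 * x ^ m) * h2
  -- the column `a = 0`, multiplied by `x − 1`
  have hC0 : (x - 1) * (2 * x ^ (g + s0) * ∑ k ∈ range ((jl - s0) / 2 + 1 - g), x ^ k) = 2 * x ^ (g + s0) * (x ^ ((jl - s0) / 2 + 1 - g) - 1) := by
    have h1 := geom_sum_mul' x ((jl - s0) / 2 + 1 - g)
    linear_combination (2 * x ^ (g + s0)) * h1
  by_cases hreg : jl + 2 ≤ m + 2 * g + s0
  · ---------------------------------------------------------------- the window `ℓ ≤ 2d − 2`: the generic part cancels, the top cells give everything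
    -- generic columns: `a + 1 ≤ ⌊jl∕2⌋ + 1 − d`
    have hG : ∀ a ∈ range (jl + 1), (if 2 * (a + 1) ≤ m ∧ 2 * g + 2 * (a + 1) + s0 ≤ jl + 2 then 2 * x ^ ((jl + s0) / 2 + (a + 1)) - 2 * (x + 1) * x ^ (2 * (a + 1) + (g + s0) - 2) else 0) =
        (if 0 ≤ a ∧ a < 0 + ((jl - s0) / 2 + 1 - g) then 2 * x ^ ((jl + s0) / 2 + 1) * x ^ a - 2 * (x + 1) * x ^ (g + s0) * x ^ (2 * a) else 0) := by
      intro a _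
      by_cases h : 2 * (a + 1) ≤ m ∧ 2 * g + 2 * (a + 1) + s0 ≤ jl + 2
      · rw [if_pos h, if_pos (by omega), show (jl + s0) / 2 + (a + 1) = ((jl + s0) / 2 + 1) + a by omega, pow_add, show 2 * (a + 1) + (g + s0) - 2 = (g + s0) + 2 * a by omega, pow_add]; ring
      · rw [if_neg h, if_neg (by omega)]
    -- top cells: `m + S♭ − ⌊(jl+s0)∕2⌋ ≤ a + 1 ≤ m − ⌊d_E∕2⌋`, `S♭ = d_E − 1 + d_E%2`
    have hT : ∀ a ∈ range (jl + 1), (if m < 2 * (a + 1) ∧ 2 * (a + 1) + (g + s0) ≤ 2 * m + 1 ∧ 2 * m + 2 * g + s0 ≤ jl + 2 * (a + 1) + 1 then 2 * x ^ ((jl + s0) / 2 + (a + 1)) else 0) =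
        (if (m + (g + s0 - 1 + (g + s0) % 2) - (jl + s0) / 2 - 1) ≤ a ∧ a < (m + (g + s0 - 1 + (g + s0) % 2) - (jl + s0) / 2 - 1) + ((jl + 1 - g) / 2 + 1 - (g + s0)) then 2 * x ^ (m + (g + s0 - 1 + (g + s0) % 2)) * x ^ (a - (m + (g + s0 - 1 + (g + s0) % 2) - (jl + s0) / 2 - 1)) else 0) := by
      intro a _
      by_cases h : m < 2 * (a + 1) ∧ 2 * (a + 1) + (g + s0) ≤ 2 * m + 1 ∧ 2 * m + 2 * g + s0 ≤ jl + 2 * (a + 1) + 1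
      · rw [if_pos h, if_pos (by omega), show (jl + s0) / 2 + (a + 1) = (m + (g + s0 - 1 + (g + s0) % 2)) + (a - (m + (g + s0 - 1 + (g + s0) % 2) - (jl + s0) / 2 - 1)) by omega, pow_add, ← mul_assoc]
      · rw [if_neg h, if_neg (by omega)]
    rw [Finset.sum_congr rfl hG, sum_range_window_reindex (fun a => 2 * x ^ ((jl + s0) / 2 + 1) * x ^ a - 2 * (x + 1) * x ^ (g + s0) * x ^ (2 * a)) (show 0 + ((jl - s0) / 2 + 1 - g) ≤ jl + 1 by omega),
      Finset.sum_congr rfl hT, sum_range_window_reindex (fun a => 2 * x ^ (m + (g + s0 - 1 + (g + s0) % 2)) * x ^ (a - (m + (g + s0 - 1 + (g + s0) % 2) - (jl + s0) / 2 - 1)))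
        (show (m + (g + s0 - 1 + (g + s0) % 2) - (jl + s0) / 2 - 1) + ((jl + 1 - g) / 2 + 1 - (g + s0)) ≤ jl + 1 by omega)]
    simp_rw [zero_add, Nat.add_sub_cancel_left]
    have hA : (x - 1) * (∑ i ∈ range ((jl - s0) / 2 + 1 - g), (2 * x ^ ((jl + s0) / 2 + 1) * x ^ i - 2 * (x + 1) * x ^ (g + s0) * x ^ (2 * i)) + 2 * x ^ (g + s0) * ∑ k ∈ range ((jl - s0) / 2 + 1 - g), x ^ k) = 0 := by
      rw [mul_add, genBlock_mul, hC0]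
      have f1 : x ^ ((jl + s0) / 2 + 1) = x ^ ((jl - s0) / 2 + 1 - g) * x ^ (g + s0) := by rw [← pow_add]; congr 1; omega
      have f2 : x ^ (2 * ((jl - s0) / 2 + 1 - g)) = x ^ ((jl - s0) / 2 + 1 - g) * x ^ ((jl - s0) / 2 + 1 - g) := by rw [← pow_add]; congr 1; omega
      rw [f1, f2]; ring
    have hA' : ∑ i ∈ range ((jl - s0) / 2 + 1 - g), (2 * x ^ ((jl + s0) / 2 + 1) * x ^ i - 2 * (x + 1) * x ^ (g + s0) * x ^ (2 * i)) + 2 * x ^ (g + s0) * ∑ k ∈ range ((jl - s0) / 2 + 1 - g), x ^ k = 0 := by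
      rcases mul_eq_zero.1 hA with h | h
      · exact absurd (sub_eq_zero.1 h) hx1
      · exact h
    have hB : (x - 1) * ∑ i ∈ range ((jl + 1 - g) / 2 + 1 - (g + s0)), 2 * x ^ (m + (g + s0 - 1 + (g + s0) % 2)) * x ^ i =
        (x - 1) * (x ^ m * (2 * ∑ i ∈ range ((jl + 1 - g) / 2 + (g + s0) % 2), x ^ i - 2 * ∑ i ∈ range (g + s0 - 1 + (g + s0) % 2), x ^ i)) := by
      rw [topBlock_mul, hR, pow_add x m (g + s0 - 1 + (g + s0) % 2)]
      have f1 : x ^ ((jl + 1 - g) / 2 + (g + s0) % 2) = x ^ (g + s0 - 1 + (g + s0) % 2) * x ^ ((jl + 1 - g) / 2 + 1 - (g + s0)) := by rw [← pow_add]; congr 1; omega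
      rw [f1]; ring
    have hB' := mul_left_cancel₀ (sub_ne_zero.2 hx1) hB
    linear_combination ε * hA' + (∑ i ∈ range ((jl + 1 - g) / 2 + 1 - (g + s0)), 2 * x ^ (m + (g + s0 - 1 + (g + s0) % 2)) * x ^ i) * hεε + hB'
  · ---------------------------------------------------------------- `ℓ ≥ 2d`: `ε = +1`, generic columns `a + 1 ≤ ⌊m∕2⌋`, top cells `⌊m∕2⌋ + 1 ≤ a + 1 ≤ m − ⌊d∕2⌋`
    have hε1 : ε = 1 := by rcases hε with h | ⟨_, h⟩; exact h; exact absurd h hreg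
    subst hε1
    have hG : ∀ a ∈ range (jl + 1), (if 2 * (a + 1) ≤ m ∧ 2 * g + 2 * (a + 1) + s0 ≤ jl + 2 then 2 * x ^ ((jl + s0) / 2 + (a + 1)) - 2 * (x + 1) * x ^ (2 * (a + 1) + (g + s0) - 2) else 0) =
        (if 0 ≤ a ∧ a < 0 + m / 2 then 2 * x ^ ((jl + s0) / 2 + 1) * x ^ a - 2 * (x + 1) * x ^ (g + s0) * x ^ (2 * a) else 0) := by
      intro a _
      by_cases h : 2 * (a + 1) ≤ m ∧ 2 * g + 2 * (a + 1) + s0 ≤ jl + 2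
      · rw [if_pos h, if_pos (by omega), show (jl + s0) / 2 + (a + 1) = ((jl + s0) / 2 + 1) + a by omega, pow_add, show 2 * (a + 1) + (g + s0) - 2 = (g + s0) + 2 * a by omega, pow_add]; ring
      · rw [if_neg h, if_neg (by omega)]
    have hT : ∀ a ∈ range (jl + 1), (if m < 2 * (a + 1) ∧ 2 * (a + 1) + (g + s0) ≤ 2 * m + 1 ∧ 2 * m + 2 * g + s0 ≤ jl + 2 * (a + 1) + 1 then 2 * x ^ ((jl + s0) / 2 + (a + 1)) else 0) =
        (if m / 2 ≤ a ∧ a < m / 2 + (m - (g + s0) / 2 - m / 2) then 2 * x ^ ((jl + s0) / 2 + m / 2 + 1) * x ^ (a - m / 2) else 0) := by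
      intro a _
      by_cases h : m < 2 * (a + 1) ∧ 2 * (a + 1) + (g + s0) ≤ 2 * m + 1 ∧ 2 * m + 2 * g + s0 ≤ jl + 2 * (a + 1) + 1
      · rw [if_pos h, if_pos (by omega), show (jl + s0) / 2 + (a + 1) = ((jl + s0) / 2 + m / 2 + 1) + (a - m / 2) by omega, pow_add, ← mul_assoc]
      · rw [if_neg h, if_neg (by omega)]
    rw [Finset.sum_congr rfl hG, sum_range_window_reindex (fun a => 2 * x ^ ((jl + s0) / 2 + 1) * x ^ a - 2 * (x + 1) * x ^ (g + s0) * x ^ (2 * a)) (show 0 + m / 2 ≤ jl + 1 by omega),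
      Finset.sum_congr rfl hT, sum_range_window_reindex (fun a => 2 * x ^ ((jl + s0) / 2 + m / 2 + 1) * x ^ (a - m / 2)) (show m / 2 + (m - (g + s0) / 2 - m / 2) ≤ jl + 1 by omega)]
    simp_rw [zero_add, Nat.add_sub_cancel_left, one_mul]
    apply mul_left_cancel₀ (sub_ne_zero.2 hx1)
    rw [mul_add, mul_add, genBlock_mul, topBlock_mul, hC0, hR]
    linear_combination far_identity_flip x hg hs0 hmS hm (by omega) hn hk e1 e2 e3 e4

end Summit.HodgeConjecture.HodgeConjecture.Cruxes.H413.F0P3cDyRamToricCensusSumRamMFlip
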